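import Mathlib
import Literature.Computability.AlgebraicComplexity.ValiantClasses
import Literature.Computability.AlgebraicComplexity.LinSubst

/-!
# Crux `DetQP.DetqpThesis` (stmt-ValiantsHypothesis-0315), line `four-dimensional-determinant` —
# calibration of stub C, part 2a: homogenised projections are linear-substitution instances

If `g = f(a)` is a Valiant projection (`IsProjection g f`: each `a i` a variable or a constant) of
a form `f` of degree `t`, and `g` is a form of degree `n ≤ t`, then homogenising the constants with
a fresh variable `y` turns the projection into a LINEAR substitution:

* `hdc2_aeval_homogenize` — with `A i := y^{[a i constant]} · a i` (in the variables `Option τ`,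
  `y = X none`), `f(A) = y^{t-n} · g` (bihomogeneity: a monomial of `f` with `j` constant slots
  contributes `y^j` times a form of degree `t - j`, and the degree-`k` components of `g = f(a)`
  vanish for `k ≠ n`);
* `hdc2_padded_mem_endOrbit` — consequently, for an injective placement `κ` of the variables of `f`
  among the `m²` matrix variables and any placement `ι` of those of `g`,
  `X₀₀^{m-n} · g(X_ι) ∈ End · (X₀₀^{m-t} · f(X_κ))` (`t ≤ m`), provided the padding position
  `(0,0)`, if it is used by `κ` at all, is projected to the constant `1`.

This is the border/padded form of "projections do not increase (border) determinantal
complexity" (Mulmuley–Sohoni 2001 §4; Bürgisser 2000 §2.1), used in part 2b to compare the padded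
permanent and the padded four-dimensional determinant inside `Δ(det_m)`.  Folklore.
-/

open MvPolynomial
open scoped BigOperators

namespace Summit.ValiantsHypothesis.ValiantsHypothesis.Theorems.DetQPDetqpThesis.HdCalibration

set_option linter.dupNamespace false

open Literature.Computability.AlgebraicComplexity

/-- A constant is not a variable (over `ℂ`). -/
theorem hdc2_C_ne_X {τ : Type} (c : ℂ) (j : τ) : (C c : MvPolynomial τ ℂ) ≠ X j := by
  classical
  intro h
  have h1 := congrArg (coeff (Finsupp.single j 1)) h
  have h2 : (0 : τ →₀ ℕ) ≠ Finsupp.single j 1 := (Finsupp.single_ne_zero.2 one_ne_zero).symm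
  rw [coeff_C, if_neg h2, coeff_X] at h1
  simp at h1

open Classical in
/-- **Homogenising a projection.**  `f` a form of degree `t`, `g = f(a)` a form of degree
`n ≤ t` with every `a i` a variable or a constant; put `A i := y · a i` if `a i` is a constant and
`A i := a i` otherwise (`y = X none` a fresh variable).  Then `f(A) = y^{t-n} · g`. -/
theorem hdc2_aeval_homogenize {σ τ : Type} [Fintype σ] [DecidableEq σ] [DecidableEq τ] {t n : ℕ}
    {f : MvPolynomial σ ℂ} (hf : f.IsHomogeneous t) {g : MvPolynomial τ ℂ} (hg : g.IsHomogeneous n)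
    (hnt : n ≤ t) (a : σ → MvPolynomial τ ℂ) (ha : ∀ i, (∃ j, a i = X j) ∨ ∃ c, a i = C c)
    (hga : g = aeval a f) :
    aeval (fun i => (X none : MvPolynomial (Option τ) ℂ) ^ (if ∃ j, a i = X j then 0 else 1) *
        rename some (a i)) f =
      (X none : MvPolynomial (Option τ) ℂ) ^ (t - n) * rename some g := by
  classical
  -- notation: `δ i = 1` iff `a i` is a constant; `κ e` = number of constant slots of `e`
  set δ : σ → ℕ := fun i => if ∃ j, a i = X j then 0 else 1 with hδ
  set A : σ → MvPolynomial (Option τ) ℂ := fun i => (X none) ^ δ i * rename some (a i) with hA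
  set κ : (σ →₀ ℕ) → ℕ := fun e => ∑ i, δ i * e i with hκ
  have hδle : ∀ i, δ i ≤ 1 := fun i => by simp only [hδ]; split_ifs <;> omega
  -- each `a i` is a form of degree `1 - δ i`
  have hahom : ∀ i, (a i).IsHomogeneous (1 - δ i) := by
    intro i
    rcases ha i with ⟨j, hj⟩ | ⟨c, hc⟩
    · have h1 : δ i = 0 := by simp only [hδ]; rw [if_pos ⟨j, hj⟩]
      rw [h1, hj]; exact isHomogeneous_X ℂ j
    · have h1 : δ i = 1 := by
        simp only [hδ]; rw [if_neg]; rintro ⟨j, hj⟩; exact hdc2_C_ne_X c j (hc.symm.trans hj)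
      rw [h1, hc]; exact isHomogeneous_C τ c
  -- monomials: `A^e = y^{κ e} · (a^e renamed)` and `a^e` is a form of degree `t - κ e`
  have hmonA : ∀ (e : σ →₀ ℕ) (r : ℂ), aeval A (monomial e r) =
      (X none) ^ κ e * rename some (aeval a (monomial e r)) := by
    intro e r
    simp only [aeval_monomial, map_mul, algebraMap_eq, rename_C]
    rw [Finsupp.prod_fintype _ _ (fun i => by simp), Finsupp.prod_fintype _ _ (fun i => by simp),
      map_prod]
    simp only [hA, mul_pow, ← pow_mul, Finset.prod_mul_distrib, Finset.prod_pow_eq_pow_sum,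
      map_pow]
    ring
  have hκle : ∀ e ∈ f.support, κ e ≤ t := by
    intro e he
    have hdeg : ∑ i, e i = t := by
      have h := hf (mem_support_iff.1 he)
      rw [Finsupp.weight_apply, Finsupp.sum_fintype _ _ (fun i => by simp)] at h
      simpa using h
    calc κ e = ∑ i, δ i * e i := rfl
      _ ≤ ∑ i, e i := Finset.sum_le_sum fun i _ => by
          have := hδle i; nlinarith
      _ = t := hdeg
  have hmonhom : ∀ e ∈ f.support, ∀ r : ℂ, (aeval a (monomial e r)).IsHomogeneous (t - κ e) := by
    intro e he r
    have hdeg : ∑ i, e i = t := by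
      have h := hf (mem_support_iff.1 he)
      rw [Finsupp.weight_apply, Finsupp.sum_fintype _ _ (fun i => by simp)] at h
      simpa using h
    simp only [aeval_monomial, algebraMap_eq]
    rw [Finsupp.prod_fintype _ _ (fun i => by simp)]
    have hprod : (∏ i, a i ^ e i).IsHomogeneous (∑ i, (1 - δ i) * e i) := by
      apply IsHomogeneous.prod
      intro i _
      simpa using (hahom i).pow (e i)
    have hsum : ∑ i, (1 - δ i) * e i = t - κ e := by
      have h1 : ∑ i, (1 - δ i) * e i + κ e = t := by
        rw [show κ e = ∑ i, δ i * e i from rfl, ← Finset.sum_add_distrib, ← hdeg]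
        refine Finset.sum_congr rfl fun i _ => ?_
        have := hδle i
        rcases Nat.le_one_iff_eq_zero_or_eq_one.1 this with h | h <;> simp [h]
      omega
    rw [hsum] at hprod
    simpa using (isHomogeneous_C τ r).mul hprod
  -- expand `f` over its support
  have hfsum : f = ∑ e ∈ f.support, monomial e (coeff e f) := f.as_sum
  have hAf : aeval A f = ∑ e ∈ f.support, (X none) ^ κ e * rename some (aeval a (monomial e (coeff e f))) := by
    conv_lhs => rw [hfsum]
    rw [map_sum]
    exact Finset.sum_congr rfl fun e _ => hmonA e _
  have hgsum : g = ∑ e ∈ f.support, aeval a (monomial e (coeff e f)) := by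
    rw [hga]; conv_lhs => rw [hfsum]; rw [map_sum]
  -- degree-`k` components of `g`
  have hcomp : ∀ k, homogeneousComponent k g =
      ∑ e ∈ f.support with t - κ e = k, aeval a (monomial e (coeff e f)) := by
    intro k
    rw [hgsum, map_sum, Finset.sum_filter]
    refine Finset.sum_congr rfl fun e he => ?_
    rw [homogeneousComponent_of_mem (hmonhom e he _)]
    by_cases h : t - κ e = k
    · rw [if_pos h, if_pos h.symm]
    · rw [if_neg h, if_neg (Ne.symm h)]
  have hcompg : ∀ k, homogeneousComponent k g = if k = n then g else 0 := fun k =>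
    homogeneousComponent_of_mem hg
  -- regroup the sum by the value of `t - κ e`
  have hregroup : ∑ e ∈ f.support, (X none : MvPolynomial (Option τ) ℂ) ^ κ e *
        rename some (aeval a (monomial e (coeff e f))) =
      ∑ k ∈ Finset.range (t + 1), (X none) ^ (t - k) *
        rename some (∑ e ∈ f.support with t - κ e = k, aeval a (monomial e (coeff e f))) := by
    rw [← Finset.sum_fiberwise_of_maps_to (g := fun e => t - κ e) (t := Finset.range (t + 1))
      (fun e _ => Finset.mem_range.2 (by omega))]
    refine Finset.sum_congr rfl fun k _ => ?_
    rw [map_sum, Finset.mul_sum]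
    refine Finset.sum_congr rfl fun e he => ?_
    rw [Finset.mem_filter] at he
    rw [show κ e = t - k by have := hκle e he.1; omega]
  rw [hAf, hregroup]
  simp only [← hcomp, hcompg]
  rw [Finset.sum_eq_single n]
  · rw [if_pos rfl]
  · intro k _ hk; rw [if_neg hk, map_zero, mul_zero]
  · intro h; exact absurd (Finset.mem_range.2 (by omega)) h

open Classical in
/-- **Padded projections are linear-substitution instances.**  Let `f` be a form of degree `t`
in variables `σ`, `g = f(a)` a projection which is a form of degree `n ≤ t ≤ m`, `κ : σ → m × m`
an injective placement and `ι : τ → m × m` any placement; assume the padding position `(0,0)`, if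
hit by `κ`, is projected to `1`.  Then `X₀₀^{m-n} g(X_ι) ∈ End · (X₀₀^{m-t} f(X_κ))`. -/
theorem hdc2_padded_mem_endOrbit {σ τ : Type} [Fintype σ] [DecidableEq σ] [DecidableEq τ]
    {m t n : ℕ} [NeZero m] {f : MvPolynomial σ ℂ} (hf : f.IsHomogeneous t)
    {g : MvPolynomial τ ℂ} (hg : g.IsHomogeneous n) (hnt : n ≤ t) (htm : t ≤ m)
    (a : σ → MvPolynomial τ ℂ) (ha : ∀ i, (∃ j, a i = X j) ∨ ∃ c, a i = C c) (hga : g = aeval a f)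
    (κ : σ → Fin m × Fin m) (hκ : Function.Injective κ)
    (hκ0 : ∀ i, κ i = ((0 : Fin m), (0 : Fin m)) → a i = C 1)
    (ι : τ → Fin m × Fin m) :
    X ((0 : Fin m), (0 : Fin m)) ^ (m - n) * rename ι g ∈
      endOrbit (Fin m × Fin m) ℂ (X ((0 : Fin m), (0 : Fin m)) ^ (m - t) * rename κ f) := by
  classical
  -- the homogenised substitution in the variables `Option τ`, transported along `θ`
  set θ : Option τ → Fin m × Fin m := fun o => o.elim ((0 : Fin m), (0 : Fin m)) ι with hθ
  set A : σ → MvPolynomial (Option τ) ℂ := fun i =>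
    (X none) ^ (if ∃ j, a i = X j then 0 else 1) * rename some (a i) with hA
  -- images of the matrix variables
  set im : Fin m × Fin m → MvPolynomial (Fin m × Fin m) ℂ := fun v =>
    if h : ∃ i, κ i = v then rename θ (A h.choose)
    else if v = ((0 : Fin m), (0 : Fin m)) then X v else 0 with him
  -- every image is a scalar multiple of a variable: `im v = c v • X (w v)`
  have hlin : ∀ v, ∃ (c : ℂ) (w : Fin m × Fin m), im v = c • X w := by
    intro v
    simp only [him]
    split_ifs with h h0
    · rcases ha h.choose with ⟨j, hj⟩ | ⟨c, hc⟩
      · refine ⟨1, ι j, ?_⟩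
        simp only [hA]
        rw [if_pos ⟨j, hj⟩, pow_zero, one_mul, hj, rename_X, rename_X, one_smul]
        rfl
      · refine ⟨c, ((0 : Fin m), (0 : Fin m)), ?_⟩
        simp only [hA]
        rw [if_neg (by rintro ⟨j, hj⟩; exact hdc2_C_ne_X c j (hc.symm.trans hj)), pow_one, hc,
          rename_C, map_mul, rename_X, rename_C, smul_eq_C_mul, mul_comm]
        rfl
    · exact ⟨1, v, by rw [one_smul]⟩
    · exact ⟨0, v, by rw [zero_smul]⟩
  choose cf w hcw using hlin
  -- the substitution matrix
  set B : Matrix (Fin m × Fin m) (Fin m × Fin m) ℂ := fun j v => if j = w v then cf v else 0 with hB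
  have hBX : ∀ v, linSubst (Fin m × Fin m) ℂ B (X v) = im v := by
    intro v
    rw [linSubst_X, hcw v, Finset.sum_eq_single (w v)]
    · simp [hB]
    · intro j _ hj; simp [hB, hj]
    · intro h; exact absurd (Finset.mem_univ _) h
  -- on the variables of `f` and on the padding variable
  have hchoose : ∀ i : σ, ∀ h : ∃ i', κ i' = κ i, h.choose = i := fun i h => hκ h.choose_spec
  have hBκ : ∀ i, linSubst (Fin m × Fin m) ℂ B (X (κ i)) = rename θ (A i) := by
    intro i
    rw [hBX]
    simp only [him, dif_pos (⟨i, rfl⟩ : ∃ i', κ i' = κ i), hchoose]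
  have hB0 : linSubst (Fin m × Fin m) ℂ B (X ((0 : Fin m), (0 : Fin m))) = X ((0 : Fin m), (0 : Fin m)) := by
    rw [hBX]
    simp only [him]
    split_ifs with h
    · -- the padding position is a variable of `f`, projected to `1`
      have h1 : a h.choose = C 1 := hκ0 _ h.choose_spec
      simp only [hA]
      rw [if_neg (by rintro ⟨j, hj⟩; exact hdc2_C_ne_X 1 j (h1.symm.trans hj)), pow_one, h1,
        rename_C, map_one, mul_one, rename_X]
      rfl
    · rfl
  -- compute the substituted padded `f`
  have hsub : linSubst (Fin m × Fin m) ℂ B (X ((0 : Fin m), (0 : Fin m)) ^ (m - t) * rename κ f) =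
      X ((0 : Fin m), (0 : Fin m)) ^ (m - n) * rename ι g := by
    rw [map_mul, map_pow, hB0]
    have h1 : linSubst (Fin m × Fin m) ℂ B (rename κ f) = rename θ (aeval A f) := by
      have h2 : (linSubst (Fin m × Fin m) ℂ B).comp (rename κ) = (rename θ).comp (aeval A) := by
        apply MvPolynomial.algHom_ext
        intro i
        rw [AlgHom.comp_apply, AlgHom.comp_apply, rename_X, hBκ, aeval_X]
      exact DFunLike.congr_fun h2 f
    rw [h1, hdc2_aeval_homogenize hf hg hnt a ha hga, map_mul, map_pow, rename_X, rename_rename]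
    have hθ0 : θ none = ((0 : Fin m), (0 : Fin m)) := rfl
    have hθs : θ ∘ some = ι := rfl
    rw [hθ0, hθs, ← mul_assoc, ← pow_add, show m - t + (t - n) = m - n by omega]
  exact ⟨B, hsub⟩

end Summit.ValiantsHypothesis.ValiantsHypothesis.Theorems.DetQPDetqpThesis.HdCalibration
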